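import Summits.BirchSwinnertonDyer.BirchSwinnertonDyer.Theorems.GenusKolyvaginAtTwoGenusPrimitiveSupplyAtTwoRelaxedAtInfinityIndex
import HarnessLib

/-!
# Route `GenusKolyvaginAtTwo`, crux #2 `GenusPrimitiveSupplyAtTwo` (stmt-BirchSwinnertonDyer-22136):
# MAZUR–RUBIN LEMMA 3.2 AT `T = {∞}`, `p = 2`, OVER `ℚ` — the ∞-SWITCH of the `2`-Selmer group in the kernel:
# `[Sel₂^{rel ∞}(E) : Sel₂^{str ∞}(E)] = #E(ℝ)/2E(ℝ)`, hence `[Sel₂^{rel ∞}(E) : Sel₂(E)] ∈ {1, 2}`, `= 1` for `Δ_E < 0`,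
# and for `Δ_E > 0`: `= 2 ⟺ res_∞ Sel₂(E) = 0` — the refinement of DESC-§17-IDX `F1Sign2.SelmerIndexInRelaxedAtInfinityAtTwo`
# (landed BY NAME by gk2-p4 g14, `GenusKolyTransp.selmerIndexInRelaxedAtInfinityAtTwo_holds`, consumed here)

Width seat `bsd-line-gk2-p5` g14 (cell `bsd-f1-sign2`, SUPPLY lineage of crux 22136, «UP general-K lane»), file 28 of the series;
sequel of files 17/18/20 (`…ArchimedeanCount`, `…ArchimedeanKummerCount`, `…ArchimedeanKummerCard`, gk2-p5 g9) and of gk2-p4 g14's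
`…RelaxedAtInfinityIndex` (the dictionary `Sel₂^{rel ∞}(W) = H¹_{kummerRelaxed {∞}}` and DESC-§17-IDX `[Sel₂^{rel ∞} : Sel₂] ∈ {1, 2}` BY NAME,
both CONSUMED here by name). THEOREMS ONLY (no definition, no named fact, no `sorry`, no local instance); helper
`--supports stmt-BirchSwinnertonDyer-22136`; no item is closed; BSD is not proved by any of this.

WHY. The ∞-relaxed `2`-Selmer group `R = Sel₂^{rel ∞}(E) ⊆ H¹(ℚ, E[2])` (the tree's `F1Sign2.selmerGroupRelaxedAtInfinityAtTwo`, -desc g9;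
Mazur–Rubin 2010 Def. 3.1 `𝒮^T` with `T = {∞}`) is the common carrier of three lanes of the cell at `Δ_E > 0`: the -desc rows
DESC-§17-IDX / DESC-§17-R / U′ / B⁰ and the whole §18 «Selmer units» packet (`F1Sign2/SelmerUnitsAtTwo.lean`: every row is keyed on
`relIndex Sel₂ R ∈ {1, 2}`), the -an lens's two-transposition door at `ε = −1` (T-2q `TwoTranspositionTwistLawAtTwo`: `R = ⟨δP₀, c_∞⟩`,
«`dim R = dim Sel₂ + [res_∞ Sel₂ = 0]`»), and this crux's twin supply on `Δ_E > 0` (the Heegner twist `d_K < 0` moves the local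
condition only at the REAL place: files 17–24 of this series). All of them quote «MR 2010 Lemma 3.2 at `T = {∞}`» as print. Part 18
(`GenusKolyArch.relIndex_kummerStrict_kummerRelaxed_singleton_inl_eq_of_facts`) proved that count for every number field and every
`n = p^k` in X11b's `kummerStrict`/`kummerRelaxed` currency, modulo the two named facts `poitouTate_selmerStructure_duality_real K` and
`localEulerPoincareCharacteristic` — BOTH NOW TREE THEOREMS (`SchneiderFreeAdditiveX3.PoitouTateReduction.poitouTate_selmerStructure_duality_real_holds`,
`localEulerPoincareCharacteristic_holds`); gk2-p4 g14 drew from it the index set `{1, 2}`. This file cashes out the EXACT SWITCH over `ℚ` at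
`n = 2` in the -desc currency, with NO hypothesis left:

* §115 DICTIONARY (sequel of gk2-p4's §21) — the relaxed group at an arbitrary `w : InfinitePlace ℚ`, the STRICT group
  `H¹_{kummerStrict {∞}} = {c ∈ R | loc_∞ c = 0}`, and the sandwich `H¹_{kummerStrict {∞}} ≤ Sel₂(W) ≤ R`.
* §116 THE COUNT — `[R : H¹_{kummerStrict {∞}}] = #𝓛_∞ = [E(ℝ) : 2E(ℝ)]`, `= 2` for `Δ > 0`, `= 1` for `Δ < 0` (Kramer 1981 Prop. 6,
  part 20), UNCONDITIONALLY.
* §117 THE SWITCH — `Δ < 0`: `R = Sel₂(W)` (index `1`; every relaxed class restricts to `0` at `∞`, `H¹(ℝ, E[2]) = 0`).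
  `Δ > 0`: `[Sel₂ : H¹_{str}]·[R : Sel₂] = 2`, so `[R : Sel₂] ∈ {1, 2}` and **`[R : Sel₂] = 2 ⟺ loc_∞ c = 0` for every `c ∈ Sel₂(W)`**
  (the UP branch: `Sel₂` strict at `∞`), `[R : Sel₂] = 1 ⟺` some Selmer class has `loc_∞ ≠ 0` (DOWN).
  (DESC-§17-IDX's «index `2` iff `res_∞ Sel₂(W) = 0`», REF1-AUDIT §47 theorem-grade, REF2 v16 §35 IN PRINT; the egg reading and the
  rank-one counts `#R = 4 / 2` are the sequel `…ArchimedeanRelaxedSwitchEgg`.)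

Honest framing: KNOWN in print (Mazur–Rubin 2010 Lemma 3.2 allows archimedean `T`; Kramer 1981 Prop. 6); kernel-new; beyond-print
theorem: no. Crux 22136 stays OPEN exactly at (U) 24947 ∧ (CONV₂) 19220/24948. BSD is not proved by any of this.

References: [MazurRubin2010] Def. 3.1, Lemma 3.2 (arXiv:0904.3709 p. 8, «Definition 26 / Lemma 27»: `T` a finite set of PLACES);
[Kramer1981] §2 Prop. 6 (p. 127); [MilneADT2006] I Ex. 1.6 (c), Thm. 2.8, Thm. 2.13, Rem. 3.7, Thm. 4.10 (b);
[Howard2004HeegnerKolyvagin] Thm. 2.1.11.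
-/

set_option linter.dupNamespace false -- tree convention: `Summit.BirchSwinnertonDyer.BirchSwinnertonDyer.Theorems` (summit = sub-problem)
set_option autoImplicit false

noncomputable section

open scoped Classical

open NumberField IsDedekindDomain WeierstrassCurve
open Literature.NumberTheory.EllipticCurves Literature.NumberTheory.GaloisRepresentations
open Literature.NumberTheory.GaloisRepresentations.DiscreteGaloisModule (SelmerStructure)
open Literature.NumberTheory.GaloisCohomology
open Summit.BirchSwinnertonDyer.Rank1Residual.X11b.KummerPT (kummerStrict kummerRelaxed kummerStrict_of_mem
  kummerStrict_of_not_mem kummerRelaxed_of_mem kummerRelaxed_of_not_mem kummerStrict_le_kummerRelaxed)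
open Summit.BirchSwinnertonDyer.Rank1Residual.F1Sign2 (selmerGroupRelaxedAtInfinityAtTwo
  mem_selmerGroupRelaxedAtInfinityAtTwo_iff selmerGroup_le_selmerGroupRelaxedAtInfinityAtTwo SelmerIndexInRelaxedAtInfinityAtTwo)
open Summit.BirchSwinnertonDyer.BirchSwinnertonDyer.Theorems.SchneiderFreeAdditiveX3.PoitouTateReduction
  (poitouTate_selmerStructure_duality_real_holds)
open Summit.BirchSwinnertonDyer.Rank1Residual.GaloisImage.EP (forall_localEulerPoincareCharacteristic_adicCompletion)
open Summit.BirchSwinnertonDyer.BirchSwinnertonDyer.Theorems.GenusKolyTransp (selmerGroupRelaxedAtInfinityAtTwo_eq_kummerRelaxed)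

namespace Summit.BirchSwinnertonDyer.BirchSwinnertonDyer.Theorems.GenusKolyArch

variable (W : WeierstrassCurve ℚ) [W.IsElliptic]

/-! ## §115 Dictionary: the ∞-relaxed and the ∞-strict `2`-Selmer groups in X11b's Kummer-structure currency -/

section Dictionary

/-- **`Sel₂^{rel ∞}(E) = H¹_{kummerRelaxed {w}}(ℚ, E[2])` at any `w : InfinitePlace ℚ`** (= gk2-p4's `selmerGroupRelaxedAtInfinityAtTwo_eq_kummerRelaxed`
at the one infinite place `Rat.infinitePlace`; `InfinitePlace ℚ` is a subsingleton). [cite: MazurRubin2010, Def. 3.1 (arXiv:0904.3709 p. 8)] -/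
theorem selmerGroupRelaxedAtInfinityAtTwo_eq_selmerGroup_kummerRelaxed (w : InfinitePlace ℚ) :
    selmerGroupRelaxedAtInfinityAtTwo W = (kummerRelaxed W 2 {(Sum.inl w : Place ℚ)}).selmerGroup := by
  obtain rfl : w = Rat.infinitePlace := Subsingleton.elim _ _
  exact selmerGroupRelaxedAtInfinityAtTwo_eq_kummerRelaxed W

/-- Membership form of the dictionary. [cite: MazurRubin2010, Def. 3.1 (arXiv:0904.3709 p. 8)] -/
theorem mem_selmerGroupRelaxedAtInfinityAtTwo_iff_mem_selmerGroup_kummerRelaxed (w : InfinitePlace ℚ)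
    (c : W.galH1Torsion ((2 : ℕ) : ℤ)) :
    c ∈ selmerGroupRelaxedAtInfinityAtTwo W ↔ c ∈ (kummerRelaxed W 2 {(Sum.inl w : Place ℚ)}).selmerGroup :=
  SetLike.ext_iff.mp (selmerGroupRelaxedAtInfinityAtTwo_eq_selmerGroup_kummerRelaxed W w) c

/-- **`H¹_{kummerStrict {∞}}(ℚ, E[2]) = {c ∈ Sel₂^{rel ∞}(E) | loc_∞ c = 0}`** — the `2`-Selmer group made STRICT at `∞`
(Mazur–Rubin's `𝒮_T`, `T = {∞}`). [cite: MazurRubin2010, Def. 3.1 (arXiv:0904.3709 p. 8)] -/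
theorem mem_selmerGroup_kummerStrict_singleton_inl_iff (w : InfinitePlace ℚ) (c : W.galH1Torsion ((2 : ℕ) : ℤ)) :
    c ∈ (kummerStrict W 2 {(Sum.inl w : Place ℚ)}).selmerGroup ↔
      c ∈ selmerGroupRelaxedAtInfinityAtTwo W ∧
        galoisCohomology.localization (W.torsionGaloisModule ((2 : ℕ) : ℤ)) (Sum.inl w) 1 c = 0 := by
  refine ((kummerStrict W 2 {(Sum.inl w : Place ℚ)}).mem_selmerGroup_iff c).trans ?_
  refine Iff.trans ?_ (and_congr_left' (mem_selmerGroupRelaxedAtInfinityAtTwo_iff_mem_selmerGroup_kummerRelaxed W w c).symm)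
  refine Iff.trans ?_ (and_congr_left' ((kummerRelaxed W 2 {(Sum.inl w : Place ℚ)}).mem_selmerGroup_iff c).symm)
  constructor
  · intro h
    refine ⟨fun v => kummerStrict_le_kummerRelaxed W 2 _ v (h v), ?_⟩
    have h0 := h (Sum.inl w)
    rw [kummerStrict_of_mem W 2 _ (Finset.mem_singleton_self _), AddSubgroup.mem_bot] at h0
    exact h0
  · rintro ⟨h, h0⟩ v
    by_cases hv : v ∈ ({(Sum.inl w : Place ℚ)} : Finset (Place ℚ))
    · rw [Finset.mem_singleton] at hv
      subst hv
      rw [kummerStrict_of_mem W 2 _ (Finset.mem_singleton_self _), AddSubgroup.mem_bot]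
      exact h0
    · rw [kummerStrict_of_not_mem W 2 _ hv]
      have hv' := h v
      rw [kummerRelaxed_of_not_mem W 2 _ hv] at hv'
      exact hv'

omit [W.IsElliptic] in
/-- **`H¹_{kummerStrict {∞}} ≤ Sel₂(W)`**: a class strict at `∞` satisfies the Kummer condition there (`0 ∈ 𝓛_∞`). [folklore] -/
theorem selmerGroup_kummerStrict_singleton_inl_le_selmerGroup (w : InfinitePlace ℚ) :
    (kummerStrict W 2 {(Sum.inl w : Place ℚ)}).selmerGroup ≤ W.selmerGroup ((2 : ℕ) : ℤ) := by
  intro c hc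
  have hc' := ((kummerStrict W 2 {(Sum.inl w : Place ℚ)}).mem_selmerGroup_iff c).mp hc
  refine (W.mem_selmerGroup_iff_forall_localization_mem ((2 : ℕ) : ℤ) c).mpr fun v => ?_
  by_cases hv : v ∈ ({(Sum.inl w : Place ℚ)} : Finset (Place ℚ))
  · have h0 := hc' v
    rw [kummerStrict_of_mem W 2 _ hv, AddSubgroup.mem_bot] at h0
    rw [h0]
    exact zero_mem _
  · have h1 := hc' v
    rw [kummerStrict_of_not_mem W 2 _ hv] at h1
    exact h1

/-- **`Sel₂(W) ≤ Sel₂^{rel ∞}(W) = H¹_{kummerRelaxed {∞}}`** (the -desc inclusion `inf_le_left`, transported). [folklore] -/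
theorem selmerGroup_le_selmerGroup_kummerRelaxed_singleton_inl (w : InfinitePlace ℚ) :
    W.selmerGroup ((2 : ℕ) : ℤ) ≤ (kummerRelaxed W 2 {(Sum.inl w : Place ℚ)}).selmerGroup := by
  rw [← selmerGroupRelaxedAtInfinityAtTwo_eq_selmerGroup_kummerRelaxed W w]
  exact selmerGroup_le_selmerGroupRelaxedAtInfinityAtTwo W

end Dictionary

/-! ## §116 The count `[Sel₂^{rel ∞} : Sel₂^{str ∞}] = #𝓛_∞` — unconditional -/

section Count

/-- **MAZUR–RUBIN LEMMA 3.2 AT `T = {∞}` for `p = 2` over `ℚ`, UNCONDITIONALLY**: `[Sel₂^{rel ∞}(E) : Sel₂^{str ∞}(E)] = #𝓛_∞`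
(`= [E(ℝ) : 2E(ℝ)] = dim_{𝔽₂} H¹_f(ℝ, E[2])` exponentiated) — part 18's archimedean Kummer count with its two named facts fed by the tree
theorems `poitouTate_selmerStructure_duality_real_holds` (Milne I 4.10 (b) + Ex. 1.6 (c)) and `localEulerPoincareCharacteristic_holds` (Tate).
[cite: MazurRubin2010, Lemma 3.2 (arXiv:0904.3709 p. 8)] [cite: MilneADT2006, Ch. I, Thm. 4.10 (b) and Thm. 2.8] -/
theorem relIndex_kummerStrict_selmerGroupRelaxedAtInfinityAtTwo_eq_natCard (w : InfinitePlace ℚ) :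
    (kummerStrict W 2 {(Sum.inl w : Place ℚ)}).selmerGroup.relIndex (selmerGroupRelaxedAtInfinityAtTwo W) =
      Nat.card (W.kummerSelmerStructure ((2 : ℕ) : ℤ) (Sum.inl w)) := by
  rw [selmerGroupRelaxedAtInfinityAtTwo_eq_selmerGroup_kummerRelaxed W w]
  exact relIndex_kummerStrict_kummerRelaxed_singleton_inl_eq_of_facts W 2 Nat.prime_two.isPrimePow
    (poitouTate_selmerStructure_duality_real_holds ℚ) (forall_localEulerPoincareCharacteristic_adicCompletion ℚ) w

/-- **`[Sel₂^{rel ∞}(E) : Sel₂^{str ∞}(E)] = 2` for `Δ_E > 0`** (`E(ℝ) ≅ S¹ × ℤ/2`, `#𝓛_∞ = 2`: part 20, Kramer 1981 Prop. 6).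
[cite: MazurRubin2010, Lemma 3.2] [cite: Kramer1981, §2 Prop. 6 (p. 127)] -/
theorem relIndex_kummerStrict_selmerGroupRelaxedAtInfinityAtTwo_eq_two_of_Δ_pos (hΔ : 0 < W.Δ) (w : InfinitePlace ℚ) :
    (kummerStrict W 2 {(Sum.inl w : Place ℚ)}).selmerGroup.relIndex (selmerGroupRelaxedAtInfinityAtTwo W) = 2 := by
  rw [relIndex_kummerStrict_selmerGroupRelaxedAtInfinityAtTwo_eq_natCard W w]
  exact natCard_kummerSelmerStructure_inl_rat_eq_two_of_Δ_pos W hΔ w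

/-- **`[Sel₂^{rel ∞}(E) : Sel₂^{str ∞}(E)] = 1` for `Δ_E < 0`** (`E(ℝ) ≅ S¹` is `2`-divisible, `#𝓛_∞ = 1`: part 20).
[cite: MazurRubin2010, Lemma 3.2] [cite: Kramer1981, §2 Prop. 6 (p. 127)] -/
theorem relIndex_kummerStrict_selmerGroupRelaxedAtInfinityAtTwo_eq_one_of_Δ_neg (hΔ : W.Δ < 0) (w : InfinitePlace ℚ) :
    (kummerStrict W 2 {(Sum.inl w : Place ℚ)}).selmerGroup.relIndex (selmerGroupRelaxedAtInfinityAtTwo W) = 1 := by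
  rw [relIndex_kummerStrict_selmerGroupRelaxedAtInfinityAtTwo_eq_natCard W w]
  exact natCard_kummerSelmerStructure_inl_rat_eq_one_of_Δ_neg W hΔ w

/-- **The two-step index formula**: `[Sel₂ : Sel₂^{str ∞}] · [Sel₂^{rel ∞} : Sel₂] = #𝓛_∞` (multiplicativity of the relative index
along `Sel₂^{str ∞} ≤ Sel₂ ≤ Sel₂^{rel ∞}`). [cite: MazurRubin2010, Lemma 3.2] -/
theorem relIndex_kummerStrict_selmerGroup_mul_relIndex_selmerGroup_relaxed_eq_natCard (w : InfinitePlace ℚ) :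
    (kummerStrict W 2 {(Sum.inl w : Place ℚ)}).selmerGroup.relIndex (W.selmerGroup ((2 : ℕ) : ℤ)) *
        (W.selmerGroup ((2 : ℕ) : ℤ)).relIndex (selmerGroupRelaxedAtInfinityAtTwo W) =
      Nat.card (W.kummerSelmerStructure ((2 : ℕ) : ℤ) (Sum.inl w)) := by
  exact (AddSubgroup.relIndex_mul_relIndex _ _ _ (selmerGroup_kummerStrict_singleton_inl_le_selmerGroup W w)
    (selmerGroup_le_selmerGroupRelaxedAtInfinityAtTwo W)).trans
    (relIndex_kummerStrict_selmerGroupRelaxedAtInfinityAtTwo_eq_natCard W w)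

end Count

/-! ## §117 The switch: `Δ < 0` (index `1`), `Δ > 0` (index `2` iff `Sel₂` is strict at `∞`) -/

section Switch

/-- **`Δ_E < 0`: `Sel₂^{rel ∞}(E) = Sel₂(E)`** — relaxing the real condition changes nothing (`H¹(ℝ, E[2]) = 0`: the count is `1` and
`Sel₂^{str ∞} ≤ Sel₂ ≤ Sel₂^{rel ∞}`). [cite: MazurRubin2010, Lemma 3.2] [cite: Kramer1981, §2 Prop. 6 (p. 127)] -/
theorem selmerGroupRelaxedAtInfinityAtTwo_eq_selmerGroup_of_Δ_neg (hΔ : W.Δ < 0) :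
    selmerGroupRelaxedAtInfinityAtTwo W = W.selmerGroup ((2 : ℕ) : ℤ) := by
  let w : InfinitePlace ℚ := Rat.infinitePlace
  have h1 := relIndex_kummerStrict_selmerGroupRelaxedAtInfinityAtTwo_eq_one_of_Δ_neg W hΔ w
  rw [AddSubgroup.relIndex_eq_one] at h1
  exact le_antisymm (h1.trans (selmerGroup_kummerStrict_singleton_inl_le_selmerGroup W w))
    (selmerGroup_le_selmerGroupRelaxedAtInfinityAtTwo W)

/-- **`Δ_E < 0`: `[Sel₂^{rel ∞}(E) : Sel₂(E)] = 1`.** [cite: MazurRubin2010, Lemma 3.2] -/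
theorem relIndex_selmerGroup_selmerGroupRelaxedAtInfinityAtTwo_eq_one_of_Δ_neg (hΔ : W.Δ < 0) :
    (W.selmerGroup ((2 : ℕ) : ℤ)).relIndex (selmerGroupRelaxedAtInfinityAtTwo W) = 1 := by
  rw [AddSubgroup.relIndex_eq_one, selmerGroupRelaxedAtInfinityAtTwo_eq_selmerGroup_of_Δ_neg W hΔ]

/-- **`Δ_E < 0`: every ∞-relaxed Selmer class restricts to `0` at `∞`** (`Sel₂^{rel ∞} = Sel₂^{str ∞}`). [cite: MazurRubin2010, Lemma 3.2] -/
theorem localization_inl_eq_zero_of_mem_selmerGroupRelaxedAtInfinityAtTwo_of_Δ_neg (hΔ : W.Δ < 0) (w : InfinitePlace ℚ)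
    {c : W.galH1Torsion ((2 : ℕ) : ℤ)} (hc : c ∈ selmerGroupRelaxedAtInfinityAtTwo W) :
    galoisCohomology.localization (W.torsionGaloisModule ((2 : ℕ) : ℤ)) (Sum.inl w) 1 c = 0 := by
  have h1 := relIndex_kummerStrict_selmerGroupRelaxedAtInfinityAtTwo_eq_one_of_Δ_neg W hΔ w
  rw [AddSubgroup.relIndex_eq_one] at h1
  exact ((mem_selmerGroup_kummerStrict_singleton_inl_iff W w c).mp (h1 hc)).2

/-- **`Δ_E > 0`: `[Sel₂ : Sel₂^{str ∞}] · [Sel₂^{rel ∞} : Sel₂] = 2`.** [cite: MazurRubin2010, Lemma 3.2] [cite: Kramer1981, §2 Prop. 6 (p. 127)] -/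
theorem relIndex_mul_relIndex_eq_two_of_Δ_pos (hΔ : 0 < W.Δ) (w : InfinitePlace ℚ) :
    (kummerStrict W 2 {(Sum.inl w : Place ℚ)}).selmerGroup.relIndex (W.selmerGroup ((2 : ℕ) : ℤ)) *
        (W.selmerGroup ((2 : ℕ) : ℤ)).relIndex (selmerGroupRelaxedAtInfinityAtTwo W) = 2 := by
  rw [relIndex_kummerStrict_selmerGroup_mul_relIndex_selmerGroup_relaxed_eq_natCard W w]
  exact natCard_kummerSelmerStructure_inl_rat_eq_two_of_Δ_pos W hΔ w

/-- **`Δ_E > 0`: `[Sel₂^{rel ∞}(E) : Sel₂(E)] ∈ {1, 2}`.** [cite: MazurRubin2010, Lemma 3.2] -/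
theorem relIndex_selmerGroup_selmerGroupRelaxedAtInfinityAtTwo_eq_one_or_eq_two_of_Δ_pos (hΔ : 0 < W.Δ) :
    (W.selmerGroup ((2 : ℕ) : ℤ)).relIndex (selmerGroupRelaxedAtInfinityAtTwo W) = 1 ∨
      (W.selmerGroup ((2 : ℕ) : ℤ)).relIndex (selmerGroupRelaxedAtInfinityAtTwo W) = 2 := by
  have h := relIndex_mul_relIndex_eq_two_of_Δ_pos W hΔ Rat.infinitePlace
  have hdvd : (W.selmerGroup ((2 : ℕ) : ℤ)).relIndex (selmerGroupRelaxedAtInfinityAtTwo W) ∣ 2 :=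
    Dvd.intro_left _ h
  exact (Nat.dvd_prime Nat.prime_two).mp hdvd

/-- **THE ∞-SWITCH, UP branch (`Δ_E > 0`): `[Sel₂^{rel ∞}(E) : Sel₂(E)] = 2 ⟺ res_∞ Sel₂(E) = 0`** (every `2`-Selmer class restricts to
`0` in `H¹(ℝ, E[2])`, i.e. `Sel₂(E)` is STRICT at `∞`) — «index `2` iff `res_∞ Sel₂(W) = 0`» of DESC-§17-IDX's docstring, the Poitou–Tate
sentence of Mazur–Rubin's proof of Lemma 3.2. [cite: MazurRubin2010, Lemma 3.2 (arXiv:0904.3709 p. 8)] -/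
theorem relIndex_selmerGroup_selmerGroupRelaxedAtInfinityAtTwo_eq_two_iff_of_Δ_pos (hΔ : 0 < W.Δ) (w : InfinitePlace ℚ) :
    (W.selmerGroup ((2 : ℕ) : ℤ)).relIndex (selmerGroupRelaxedAtInfinityAtTwo W) = 2 ↔
      ∀ c ∈ W.selmerGroup ((2 : ℕ) : ℤ),
        galoisCohomology.localization (W.torsionGaloisModule ((2 : ℕ) : ℤ)) (Sum.inl w) 1 c = 0 := by
  have h := relIndex_mul_relIndex_eq_two_of_Δ_pos W hΔ w
  constructor
  · intro h2 c hc
    rw [h2] at h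
    have h1 : (kummerStrict W 2 {(Sum.inl w : Place ℚ)}).selmerGroup.relIndex (W.selmerGroup ((2 : ℕ) : ℤ)) = 1 := by
      omega
    rw [AddSubgroup.relIndex_eq_one] at h1
    exact ((mem_selmerGroup_kummerStrict_singleton_inl_iff W w c).mp (h1 hc)).2
  · intro hall
    have hle : W.selmerGroup ((2 : ℕ) : ℤ) ≤ (kummerStrict W 2 {(Sum.inl w : Place ℚ)}).selmerGroup := fun c hc =>
      (mem_selmerGroup_kummerStrict_singleton_inl_iff W w c).mpr
        ⟨selmerGroup_le_selmerGroupRelaxedAtInfinityAtTwo W hc, hall c hc⟩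
    have h1 : (kummerStrict W 2 {(Sum.inl w : Place ℚ)}).selmerGroup.relIndex (W.selmerGroup ((2 : ℕ) : ℤ)) = 1 :=
      AddSubgroup.relIndex_eq_one.mpr hle
    rw [h1, one_mul] at h
    exact h

/-- **THE ∞-SWITCH, DOWN branch (`Δ_E > 0`): `[Sel₂^{rel ∞}(E) : Sel₂(E)] = 1 ⟺ some `2`-Selmer class has `res_∞ ≠ 0`**
(then `Sel₂(E) = Sel₂^{rel ∞}(E)`). [cite: MazurRubin2010, Lemma 3.2 (arXiv:0904.3709 p. 8)] -/
theorem relIndex_selmerGroup_selmerGroupRelaxedAtInfinityAtTwo_eq_one_iff_of_Δ_pos (hΔ : 0 < W.Δ) (w : InfinitePlace ℚ) :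
    (W.selmerGroup ((2 : ℕ) : ℤ)).relIndex (selmerGroupRelaxedAtInfinityAtTwo W) = 1 ↔
      ∃ c ∈ W.selmerGroup ((2 : ℕ) : ℤ),
        galoisCohomology.localization (W.torsionGaloisModule ((2 : ℕ) : ℤ)) (Sum.inl w) 1 c ≠ 0 := by
  have h12 := relIndex_selmerGroup_selmerGroupRelaxedAtInfinityAtTwo_eq_one_or_eq_two_of_Δ_pos W hΔ
  have hiff := relIndex_selmerGroup_selmerGroupRelaxedAtInfinityAtTwo_eq_two_iff_of_Δ_pos W hΔ w
  constructor
  · intro h1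
    by_contra hne
    push Not at hne
    have h2 := hiff.mpr hne
    omega
  · rintro ⟨c, hc, hne⟩
    rcases h12 with h1 | h2
    · exact h1
    · exact absurd (hiff.mp h2 c hc) hne

/-- **`Δ_E > 0`, DOWN branch as an equality: some Selmer class with `res_∞ ≠ 0` ⟹ `Sel₂^{rel ∞}(E) = Sel₂(E)`.**
[cite: MazurRubin2010, Lemma 3.2 (arXiv:0904.3709 p. 8)] -/
theorem selmerGroupRelaxedAtInfinityAtTwo_eq_selmerGroup_of_exists_localization_ne_zero (hΔ : 0 < W.Δ) (w : InfinitePlace ℚ)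
    (h : ∃ c ∈ W.selmerGroup ((2 : ℕ) : ℤ),
      galoisCohomology.localization (W.torsionGaloisModule ((2 : ℕ) : ℤ)) (Sum.inl w) 1 c ≠ 0) :
    selmerGroupRelaxedAtInfinityAtTwo W = W.selmerGroup ((2 : ℕ) : ℤ) := by
  have h1 := (relIndex_selmerGroup_selmerGroupRelaxedAtInfinityAtTwo_eq_one_iff_of_Δ_pos W hΔ w).mpr h
  rw [AddSubgroup.relIndex_eq_one] at h1
  exact le_antisymm h1 (selmerGroup_le_selmerGroupRelaxedAtInfinityAtTwo W)

/-- **`Δ_E > 0`, UP branch as an equality: `res_∞ Sel₂(E) = 0` ⟹ `Sel₂(E) = Sel₂^{str ∞}(E)`** (so `Sel₂^{rel ∞}/Sel₂ ≅ 𝓛_∞ ≅ ℤ/2`).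
[cite: MazurRubin2010, Lemma 3.2 (arXiv:0904.3709 p. 8)] -/
theorem selmerGroup_eq_selmerGroup_kummerStrict_of_forall_localization_eq_zero (w : InfinitePlace ℚ)
    (hall : ∀ c ∈ W.selmerGroup ((2 : ℕ) : ℤ),
      galoisCohomology.localization (W.torsionGaloisModule ((2 : ℕ) : ℤ)) (Sum.inl w) 1 c = 0) :
    W.selmerGroup ((2 : ℕ) : ℤ) = (kummerStrict W 2 {(Sum.inl w : Place ℚ)}).selmerGroup :=
  le_antisymm (fun c hc => (mem_selmerGroup_kummerStrict_singleton_inl_iff W w c).mpr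
      ⟨selmerGroup_le_selmerGroupRelaxedAtInfinityAtTwo W hc, hall c hc⟩)
    (selmerGroup_kummerStrict_singleton_inl_le_selmerGroup W w)

end Switch


end Summit.BirchSwinnertonDyer.BirchSwinnertonDyer.Theorems.GenusKolyArch

end
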